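import Literature.AlgebraicGeometry.FundamentalGroup.HypersurfaceComplementPencilDiscriminant
import HarnessLib

/-!
# The pencil discriminant along a line: moving the base point on a transversal line

Topic `Literature/AlgebraicGeometry/FundamentalGroup`.  Complement to `HypersurfaceComplementPencilDiscriminant`:
the genericity condition `pencilDiscr h (b, v) ≠ 0` of Zariski's theorem (file
`HypersurfaceComplementZariskiPencils`; Dimca, Ch. 4 Prop. (3.1): the line meets `V(h)` transversally in
`deg` points) is a condition on the LINE `b + ℂ v` together with `b ∉ V(h)`: it persists at every other base
point `b + u v` of the same line off `V(h)` (`eval_pencilDiscr_ne_zero_of_shift`), because the restriction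
`c ↦ h(b + uv + cv)` is the shift `c ↦ c + u` of `c ↦ h(b + cv)` (`linePoly_add_smul`), which preserves the
degree, the leading coefficient and separability.  Also: a direction with `pencilDiscr h (b, v) ≠ 0` is
non-zero as soon as `h` is not constant (`ne_zero_of_pencilDiscr`).

Everything is proved; no definitions, no named facts.

## References

* A. Dimca, *Singularities and Topology of Hypersurfaces*, Universitext (1992), Ch. 4 §3 Prop. (3.1) (held text
  p. 115). [Dimca1992]
* I. R. Shafarevich, *Basic Algebraic Geometry 1*, I §3.1. [Shafarevich1994]
-/

noncomputable section

open MvPolynomial Set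
open scoped Polynomial

namespace Literature.AlgebraicGeometry.FundamentalGroup

variable {ι : Type} {h : MvPolynomial ι ℂ} {b v : ι → ℂ}

/-- **Moving the base point along the line shifts the restriction**: `h(b + uv + Xv) = h(b + Xv) ∘ (X + u)`.
[cite: Dimca1992, Ch. 4 §3 Prop. (3.1)] -/
theorem linePoly_add_smul (h : MvPolynomial ι ℂ) (b v : ι → ℂ) (u : ℂ) :
    linePoly h (b + u • v) v = (linePoly h b v).comp (Polynomial.X + Polynomial.C u) := by
  refine Polynomial.funext fun c => ?_
  rw [eval_linePoly, Polynomial.eval_comp, Polynomial.eval_add, Polynomial.eval_X, Polynomial.eval_C, eval_linePoly,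
    add_assoc, ← add_smul, add_comm u c]

/-- The leading coefficient factor of `pencilDiscr`, evaluated: it is the coefficient of `X^N` of the
restriction, `N = deg_X lineRestr₂ h`. [cite: Shafarevich1994, Book 1 I §3.1] -/
theorem eval_leadingCoeff_lineRestr₂ (h : MvPolynomial ι ℂ) (b v : ι → ℂ) :
    MvPolynomial.eval (Sum.elim b v) (lineRestr₂ h).leadingCoeff = (linePoly h b v).coeff (lineRestr₂ h).natDegree := by
  rw [linePoly, Polynomial.coeff_map, Polynomial.leadingCoeff]

/-- **The pencil discriminant persists along a transversal line**: if `pencilDiscr h (b, v) ≠ 0` then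
`pencilDiscr h (b + uv, v) ≠ 0` at every point `b + uv` of the line off `V(h)`.
[cite: Dimca1992, Ch. 4 §3 Prop. (3.1) (transversality and the number of intersection points are properties of the line)] -/
theorem eval_pencilDiscr_ne_zero_of_shift (hQ : MvPolynomial.eval (Sum.elim b v) (pencilDiscr h) ≠ 0) (u : ℂ)
    (hbu : MvPolynomial.eval (b + u • v) h ≠ 0) :
    MvPolynomial.eval (Sum.elim (b + u • v) v) (pencilDiscr h) ≠ 0 := by
  have hdeg := natDegree_linePoly_of_pencilDiscr hQ
  have hsep := separable_linePoly_of_pencilDiscr hQ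
  have hlc : MvPolynomial.eval (Sum.elim b v) (lineRestr₂ h).leadingCoeff ≠ 0 := by
    have h1 := hQ
    rw [pencilDiscr, map_mul, map_mul] at h1
    exact left_ne_zero_of_mul (right_ne_zero_of_mul h1)
  have hq1 : (Polynomial.X + Polynomial.C u : ℂ[X]).natDegree = 1 := Polynomial.natDegree_X_add_C u
  have hq0 : (Polynomial.X + Polynomial.C u : ℂ[X]).natDegree ≠ 0 := by rw [hq1]; exact one_ne_zero
  have hshift := linePoly_add_smul h b v u
  -- the degree and the leading coefficient are unchanged
  have hdeg' : (linePoly h (b + u • v) v).natDegree = (lineRestr₂ h).natDegree := by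
    rw [hshift, Polynomial.natDegree_comp, hq1, mul_one, hdeg]
  have hlc' : MvPolynomial.eval (Sum.elim (b + u • v) v) (lineRestr₂ h).leadingCoeff ≠ 0 := by
    rw [eval_leadingCoeff_lineRestr₂, ← hdeg', Polynomial.coeff_natDegree, hshift, Polynomial.leadingCoeff_comp hq0,
      Polynomial.leadingCoeff_X_add_C, one_pow, mul_one, Polynomial.leadingCoeff, hdeg,
      ← eval_leadingCoeff_lineRestr₂]
    exact hlc
  -- separability is preserved by the shift
  have hsep' : (linePoly h (b + u • v) v).Separable := by
    rw [hshift, Polynomial.separable_def, Polynomial.derivative_comp, Polynomial.derivative_add,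
      Polynomial.derivative_X, Polynomial.derivative_C, add_zero, one_mul]
    have hc := (Polynomial.separable_def _).1 hsep
    have := hc.map (Polynomial.compRingHom (Polynomial.X + Polynomial.C u))
    simpa only [Polynomial.coe_compRingHom_apply] using this
  exact eval_pencilDiscr_ne_zero hbu hlc' hsep'

/-- The restriction to the pointed line `(b, 0)` (zero direction) is the constant `h(b)`. [folklore] -/
private theorem linePoly_zero_dir (h : MvPolynomial ι ℂ) (b : ι → ℂ) : linePoly h b 0 = Polynomial.C (MvPolynomial.eval b h) := by
  refine Polynomial.funext fun c => ?_
  rw [eval_linePoly, Polynomial.eval_C, smul_zero, add_zero]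

/-- **A direction with `pencilDiscr h (b, v) ≠ 0` is non-zero** when `h` is not constant: along the zero
direction the restriction is constant, of degree `0 < deg_X lineRestr₂ h`.
[cite: Dimca1992, Ch. 4 §3 Prop. (3.1)] -/
theorem ne_zero_of_pencilDiscr {x y : ι → ℂ} (hxy : MvPolynomial.eval x h ≠ MvPolynomial.eval y h)
    (hQ : MvPolynomial.eval (Sum.elim b v) (pencilDiscr h) ≠ 0) : v ≠ 0 := by
  intro hv
  subst hv
  have hdeg := natDegree_linePoly_of_pencilDiscr hQ
  rw [linePoly_zero_dir, Polynomial.natDegree_C] at hdeg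
  -- `deg_X lineRestr₂ h ≠ 0`: the line from `x` towards `y` has a non-constant restriction
  have hle := natDegree_linePoly_le h x (y - x)
  rw [← hdeg, Nat.le_zero] at hle
  have h0 := Polynomial.eq_C_of_natDegree_eq_zero hle
  have h1 : (linePoly h x (y - x)).eval 1 = (linePoly h x (y - x)).eval 0 := by
    rw [h0, Polynomial.eval_C, Polynomial.eval_C]
  rw [eval_linePoly, eval_linePoly, one_smul, zero_smul, add_zero, add_sub_cancel] at h1
  exact hxy h1.symm

/-- For `h` irreducible every direction with `pencilDiscr h (b, v) ≠ 0` is non-zero (an irreducible complex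
polynomial is not constant). [cite: Dimca1992, Ch. 4 §3 Prop. (3.1)] -/
theorem ne_zero_of_pencilDiscr_of_irreducible (hirr : Irreducible h)
    (hQ : MvPolynomial.eval (Sum.elim b v) (pencilDiscr h) ≠ 0) : v ≠ 0 := by
  -- an irreducible polynomial over `ℂ` takes two different values
  by_cases hconst : ∀ x y : ι → ℂ, MvPolynomial.eval x h = MvPolynomial.eval y h
  · exfalso
    have hC : h = C (MvPolynomial.eval 0 h) :=
      MvPolynomial.funext fun x => by rw [MvPolynomial.eval_C]; exact hconst x 0
    have hne : MvPolynomial.eval 0 h ≠ 0 := fun h0 => hirr.ne_zero (by rw [hC, h0, map_zero])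
    exact hirr.not_isUnit (by rw [hC]; exact (MvPolynomial.isUnit_iff_eq_C_of_isReduced).2 ⟨_, isUnit_iff_ne_zero.2 hne, rfl⟩)
  · push Not at hconst
    obtain ⟨x, y, hxy⟩ := hconst
    exact ne_zero_of_pencilDiscr hxy hQ

end Literature.AlgebraicGeometry.FundamentalGroup

end
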